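import Summits.RiemannHypothesis.RiemannHypothesis.Theorems.SpectralTracePickSlopeDefs
import Mathlib.Analysis.Calculus.SmoothSeries
import Mathlib.Analysis.Calculus.Deriv.Inv
import Mathlib.Analysis.Calculus.Deriv.Slope

/-!
# RiemannHypothesis / SpectralTrace — the mass law `stub_massLaw` of the line `pick-slope`

Crux item `WindowTracePrime2` (stmt-RiemannHypothesis-11196), line `pick-slope`, registered stub
`stub_massLaw` (this file `--supports` the item; it closes nothing by itself). For real-axis resolvent
data `R = (A B; C D)`, `AD - BC = 1` (`PickSlope.Resolvent`) and a parameter `p` (`some τ`, a meromorphic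
Herglotz function in Chebotarev–Levin form, `PickSlope.PickParam`; or `none = ∞`), the Möbius image
`m_p = (Aτ + B)/(Cτ + D)` has the real-axis residues predicted by the mass law:
`(x - t) m_p(t) → (R.invMass p x)⁻¹` on `𝓝[≠] x` at a crossing `x ∈ R.atoms p` with
`R.invMass p x ≠ 0`, and `→ 0` off the crossing set. Pure real calculus from `AD - BC = 1`: termwise
differentiation of the Mittag-Leffler series of `τ` off its poles (`MassLaw.hasDerivAt_val`), its pole
expansion (`MassLaw.tendsto_val_pole`) and the residue of a quotient at a simple zero of the
denominator (`MassLaw.tendsto_residue`). RH-free; no hypothesis beyond the definitions file.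
-/

noncomputable section

open Filter Set
open scoped Topology

set_option linter.dupNamespace false

namespace Summit.RiemannHypothesis.RiemannHypothesis.Theorems.PickSlope

namespace MassLaw

/-! ## Far-pole estimates for the regularised Cauchy kernel `1/(s - t) - s/(1 + s²)` -/

/-- Far poles: `|s| ≥ 2(|t| + 1)` forces `|s - t| ≥ 1` and `|s| ≤ 2|s - t|`. [folklore] -/
theorem far_aux {s t : ℝ} (h : 2 * (|t| + 1) ≤ |s|) : 1 ≤ |s - t| ∧ |s| ≤ 2 * |s - t| := by
  have h1 := abs_sub_abs_le_abs_sub s t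
  constructor <;> linarith [abs_nonneg t]

/-- `|1/(s - t) - s/(1 + s²)| ≤ (1 + 2|t|)/(1 + s²)` for a far pole, `|s| ≥ 2(|t| + 1)`.
[folklore] -/
theorem far_val_bound {s t : ℝ} (h : 2 * (|t| + 1) ≤ |s|) :
    |1 / (s - t) - s / (1 + s ^ 2)| ≤ (1 + 2 * |t|) / (1 + s ^ 2) := by
  obtain ⟨h1, h2⟩ := far_aux h
  have hst : 0 < |s - t| := by linarith
  have hs2 : (0 : ℝ) < 1 + s ^ 2 := by positivity
  rw [div_sub_div _ _ (abs_pos.1 hst) hs2.ne', abs_div, abs_mul, abs_of_pos hs2,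
    div_le_div_iff₀ (mul_pos hst hs2) hs2, show 1 * (1 + s ^ 2) - (s - t) * s = 1 + t * s by ring]
  have key : |1 + t * s| ≤ (1 + 2 * |t|) * |s - t| :=
    calc |1 + t * s| ≤ |1| + |t * s| := abs_add_le _ _
      _ = 1 + |t| * |s| := by rw [abs_one, abs_mul]
      _ ≤ |s - t| + |t| * (2 * |s - t|) := by gcongr
      _ = (1 + 2 * |t|) * |s - t| := by ring
  calc |1 + t * s| * (1 + s ^ 2) ≤ ((1 + 2 * |t|) * |s - t|) * (1 + s ^ 2) :=
        mul_le_mul_of_nonneg_right key hs2.le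
    _ = (1 + 2 * |t|) * (|s - t| * (1 + s ^ 2)) := by ring

/-- `1/(s - t)² ≤ 8/(1 + s²)` for a far pole `|s| ≥ 2(|t| + 1)`. [folklore] -/
theorem far_deriv_bound {s t : ℝ} (h : 2 * (|t| + 1) ≤ |s|) :
    1 / (s - t) ^ 2 ≤ 8 / (1 + s ^ 2) := by
  obtain ⟨h1, h2⟩ := far_aux h
  have hsq1 : (1 : ℝ) ^ 2 ≤ (s - t) ^ 2 := by simpa only [sq_abs] using pow_le_pow_left₀ zero_le_one h1 2
  have hsq2 : s ^ 2 ≤ (2 * |s - t|) ^ 2 := by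
    simpa only [sq_abs] using pow_le_pow_left₀ (abs_nonneg s) h2 2
  rw [mul_pow, sq_abs] at hsq2
  rw [div_le_div_iff₀ (by linarith) (by positivity)]
  linarith

/-! ## The Mittag-Leffler series of a Pick parameter: summability, termwise differentiation, poles -/

/-- The weighted Mittag-Leffler series `Σ_k w_k (1/(s_k - t) - s_k/(1 + s_k²))`, `|w_k| ≤ c_k`, converges at
every real `t`: the far poles are dominated by `(1 + 2|t|) c_k/(1 + s_k²)`, the others are finitely many.
[folklore] -/
theorem summable_mlTerm (τ : PickParam) (w : τ.ι → ℝ) (hw : ∀ k, |w k| ≤ τ.c k) (t : ℝ) :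
    Summable fun k => w k * (1 / (τ.s k - t) - τ.s k / (1 + τ.s k ^ 2)) := by
  refine ((τ.poles_locallyFinite (2 * (|t| + 1))).summable_compl_iff).1
    (Summable.of_norm_bounded ((τ.summable.mul_left (1 + 2 * |t|)).subtype _) ?_)
  rintro ⟨k, hk⟩
  have hk' : 2 * (|t| + 1) ≤ |τ.s k| := le_of_lt (not_le.1 hk)
  simp only [Function.comp_apply, Real.norm_eq_abs, abs_mul]
  calc |w k| * |1 / (τ.s k - t) - τ.s k / (1 + τ.s k ^ 2)|
        ≤ τ.c k * ((1 + 2 * |t|) / (1 + τ.s k ^ 2)) :=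
        mul_le_mul (hw k) (far_val_bound hk') (abs_nonneg _) (τ.c_pos k).le
    _ = (1 + 2 * |t|) * (τ.c k / (1 + τ.s k ^ 2)) := by ring

/-- TERMWISE DIFFERENTIATION of the weighted Mittag-Leffler series at a point `x` with no active pole
(`w_k ≠ 0 → s_k ≠ x`): the derivative is `Σ_k w_k/(s_k - x)²`. On a small ball around `x` the finitely many
active poles of height `≤ 2(|x| + 2)` stay at distance `≥ δ` and the others obey the far-pole bound, so the
termwise derivatives are dominated by a multiple of `c_k/(1 + s_k²)` and `hasDerivAt_tsum_of_isPreconnected`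
applies. [folklore] -/
theorem hasDerivAt_tsum_mlTerm (τ : PickParam) (w : τ.ι → ℝ) (hw : ∀ k, |w k| ≤ τ.c k) (x : ℝ)
    (hx : ∀ k, w k ≠ 0 → τ.s k ≠ x) :
    HasDerivAt (fun t => ∑' k, w k * (1 / (τ.s k - t) - τ.s k / (1 + τ.s k ^ 2)))
      (∑' k, w k / (τ.s k - x) ^ 2) x := by
  set K : ℝ := 2 * (|x| + 2) with hK
  -- a radius `δ ≤ 1` keeping the finitely many active poles of height `≤ K` at distance `≥ 2δ` from `x`
  obtain ⟨δ, hδ0, hδ1, hδF⟩ :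
      ∃ δ : ℝ, 0 < δ ∧ δ ≤ 1 ∧ ∀ k, |τ.s k| ≤ K → w k ≠ 0 → 2 * δ ≤ |τ.s k - x| := by
    have hF : {k | |τ.s k| ≤ K ∧ w k ≠ 0}.Finite := (τ.poles_locallyFinite K).subset fun k hk => hk.1
    obtain ⟨ε, hε, hball⟩ := Metric.isOpen_iff.1 (hF.image τ.s).isClosed.isOpen_compl x
      (by rintro ⟨k, hk, hkx⟩; exact hx k hk.2 hkx)
    refine ⟨min (ε / 2) 1, lt_min (by linarith) one_pos, min_le_right _ _, fun k hk hk0 => ?_⟩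
    have hk' : τ.s k ∉ Metric.ball x ε := fun h => hball h ⟨k, ⟨hk, hk0⟩, rfl⟩
    rw [Metric.mem_ball, Real.dist_eq, not_lt] at hk'
    linarith [min_le_left (ε / 2) 1]
  -- the dominating constant
  set M : ℝ := 8 + (1 + K ^ 2) / δ ^ 2 with hM
  have hM8 : 8 ≤ M := le_add_of_nonneg_right (by positivity)
  -- on the ball the active poles do not vanish and the derivative kernel is dominated
  have key : ∀ k, ∀ y ∈ Metric.ball x δ, (w k ≠ 0 → τ.s k - y ≠ 0) ∧
      |w k| / (τ.s k - y) ^ 2 ≤ M * (τ.c k / (1 + τ.s k ^ 2)) := by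
    intro k y hy
    rw [Metric.mem_ball, Real.dist_eq] at hy
    have hck : 0 ≤ τ.c k / (1 + τ.s k ^ 2) := div_nonneg (τ.c_pos k).le (by positivity)
    by_cases hk0 : w k = 0
    · exact ⟨fun h => (h hk0).elim, by rw [hk0, abs_zero, zero_div]; exact mul_nonneg (by linarith) hck⟩
    by_cases hnear : |τ.s k| ≤ K
    · have hsy : δ < |τ.s k - y| := by
        have h := abs_sub_abs_le_abs_sub (τ.s k - x) (y - x)
        rw [show τ.s k - x - (y - x) = τ.s k - y by ring] at h
        linarith [hδF k hnear hk0]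
      refine ⟨fun _ => abs_pos.1 (by linarith), ?_⟩
      have hδsq : δ ^ 2 ≤ (τ.s k - y) ^ 2 := by
        simpa only [sq_abs] using pow_le_pow_left₀ hδ0.le hsy.le 2
      have hsK : τ.s k ^ 2 ≤ K ^ 2 := by simpa only [sq_abs] using pow_le_pow_left₀ (abs_nonneg _) hnear 2
      have hcoef : (1 + τ.s k ^ 2) / δ ^ 2 ≤ M := by
        have : (1 + τ.s k ^ 2) / δ ^ 2 ≤ (1 + K ^ 2) / δ ^ 2 := by gcongr
        linarith
      calc |w k| / (τ.s k - y) ^ 2 ≤ τ.c k / δ ^ 2 := div_le_div₀ (τ.c_pos k).le (hw k) (by positivity) hδsq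
        _ = (1 + τ.s k ^ 2) / δ ^ 2 * (τ.c k / (1 + τ.s k ^ 2)) := by field_simp
        _ ≤ M * (τ.c k / (1 + τ.s k ^ 2)) := mul_le_mul_of_nonneg_right hcoef hck
    · have hfar : 2 * (|y| + 1) ≤ |τ.s k| := by
        have hy' : |y| ≤ |x| + |y - x| := by simpa only [add_sub_cancel] using abs_add_le x (y - x)
        linarith [not_le.1 hnear]
      have h1 := (far_aux hfar).1
      refine ⟨fun _ => abs_pos.1 (by linarith), ?_⟩
      calc |w k| / (τ.s k - y) ^ 2 = |w k| * (1 / (τ.s k - y) ^ 2) := by ring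
        _ ≤ τ.c k * (8 / (1 + τ.s k ^ 2)) :=
            mul_le_mul (hw k) (far_deriv_bound hfar) (by positivity) (τ.c_pos k).le
        _ = 8 * (τ.c k / (1 + τ.s k ^ 2)) := by ring
        _ ≤ M * (τ.c k / (1 + τ.s k ^ 2)) := mul_le_mul_of_nonneg_right hM8 hck
  -- termwise derivatives on the ball
  have hderiv : ∀ k, ∀ y ∈ Metric.ball x δ, HasDerivAt
      (fun t => w k * (1 / (τ.s k - t) - τ.s k / (1 + τ.s k ^ 2))) (w k / (τ.s k - y) ^ 2) y := by
    intro k y hy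
    by_cases hk0 : w k = 0
    · simpa only [hk0, zero_mul, zero_div] using hasDerivAt_const y (0 : ℝ)
    have h1 : HasDerivAt (fun t => τ.s k - t) (-1) y := (hasDerivAt_id' y).const_sub (τ.s k)
    have h2 := ((h1.fun_inv ((key k y hy).1 hk0)).sub_const (τ.s k / (1 + τ.s k ^ 2))).const_mul (w k)
    simp only [one_div]
    exact h2.congr_deriv (by rw [neg_neg, ← div_eq_mul_one_div])
  refine hasDerivAt_tsum_of_isPreconnected (g' := fun k t => w k / (τ.s k - t) ^ 2)
    (τ.summable.mul_left M) Metric.isOpen_ball (convex_ball x δ).isPreconnected hderiv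
    (fun k y hy => ?_) (Metric.mem_ball_self hδ0) (summable_mlTerm τ w hw x) (Metric.mem_ball_self hδ0)
  rw [Real.norm_eq_abs, abs_div, abs_of_nonneg (sq_nonneg (τ.s k - y))]
  exact (key k y hy).2

/-- `τ` is differentiable off its poles, with derivative `τ.slope`. [folklore] -/
theorem hasDerivAt_val (τ : PickParam) {x : ℝ} (hx : x ∉ τ.poles) : HasDerivAt τ.val (τ.slope x) x := by
  have h := hasDerivAt_tsum_mlTerm τ τ.c (fun k => (abs_of_pos (τ.c_pos k)).le) x (fun k _ hk => hx ⟨k, hk⟩)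
  have h2 : HasDerivAt (fun t => τ.a * t + τ.b) (τ.a * 1) x := ((hasDerivAt_id' x).const_mul τ.a).add_const _
  exact (h2.add h).congr_deriv (by rw [mul_one]; rfl)

/-- The weight at a pole is the corresponding coefficient, `τ.weight (s_j) = c_j` (poles are injective).
[folklore] -/
theorem weight_pole (τ : PickParam) (j : τ.ι) : τ.weight (τ.s j) = τ.c j := by
  have h : ∃ k, τ.s k = τ.s j := ⟨j, rfl⟩
  rw [PickParam.weight, dif_pos h, τ.s_injective h.choose_spec]

/-- POLE EXPANSION: at a pole `s_j`, `(s_j - t) τ(t) → c_j` on `𝓝[≠] s_j` (the series with the `j`-th term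
switched off is differentiable, hence continuous, at `s_j`). [folklore] -/
theorem tendsto_val_pole (τ : PickParam) (j : τ.ι) :
    Tendsto (fun t => (τ.s j - t) * τ.val t) (𝓝[≠] (τ.s j)) (𝓝 (τ.c j)) := by
  classical
  set x := τ.s j with hxdef
  -- the weights with the `j`-th one switched off, and the regular part `Rr`
  set w : τ.ι → ℝ := fun k => if k = j then 0 else τ.c k with hw
  have hw1 : ∀ k, |w k| ≤ τ.c k := fun k => by
    by_cases hk : k = j <;> simp [hw, hk, (τ.c_pos j).le, abs_of_pos (τ.c_pos k)]
  have hw2 : ∀ k, w k ≠ 0 → τ.s k ≠ x := fun k hk h =>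
    hk (by simp [hw, τ.s_injective (h.trans hxdef)])
  set Rr : ℝ → ℝ := fun t => ∑' k, w k * (1 / (τ.s k - t) - τ.s k / (1 + τ.s k ^ 2)) with hRr
  have hRc : ContinuousAt Rr x := (hasDerivAt_tsum_mlTerm τ w hw1 x hw2).continuousAt
  -- splitting off the `j`-th term
  have hdec : ∀ t, τ.val t = τ.a * t + τ.b + (τ.c j * (1 / (x - t) - x / (1 + x ^ 2)) + Rr t) := by
    intro t
    have h2 : ∑' k, (if k = j then 0 else τ.c k * (1 / (τ.s k - t) - τ.s k / (1 + τ.s k ^ 2))) = Rr t :=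
      tsum_congr fun k => by by_cases hk : k = j <;> simp [hw, hk]
    rw [← h2, ← (summable_mlTerm τ τ.c (fun k => (abs_of_pos (τ.c_pos k)).le) t).tsum_eq_add_tsum_ite j]
    rfl
  -- the limit of the regular part
  have hcont : Tendsto (fun t => τ.c j + (x - t) * (τ.a * t + τ.b - τ.c j * (x / (1 + x ^ 2)) + Rr t))
      (𝓝[≠] x) (𝓝 (τ.c j)) := by
    have ha : ContinuousAt (fun t => τ.a * t + τ.b - τ.c j * (x / (1 + x ^ 2))) x := by fun_prop
    have hb : ContinuousAt (fun t : ℝ => x - t) x := by fun_prop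
    have h1 : ContinuousAt
        (fun t => τ.c j + (x - t) * (τ.a * t + τ.b - τ.c j * (x / (1 + x ^ 2)) + Rr t)) x :=
      continuousAt_const.add (hb.mul (ha.add hRc))
    have h2 := h1.tendsto
    simp only [sub_self, zero_mul, add_zero] at h2
    exact tendsto_nhdsWithin_of_tendsto_nhds h2
  refine hcont.congr' ?_
  filter_upwards [self_mem_nhdsWithin] with t ht
  have hxt : x - t ≠ 0 := sub_ne_zero.2 (Ne.symm ht)
  rw [hdec t]
  field_simp
  ring

/-! ## Limit algebra on the punctured neighbourhood -/

/-- If `f` is differentiable at `x` with `f x = 0` then `f t/(t - x) → f′(x)` on `𝓝[≠] x`. [folklore] -/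
theorem tendsto_div_sub_of_hasDerivAt {f : ℝ → ℝ} {f' x : ℝ} (hf : HasDerivAt f f' x) (h0 : f x = 0) :
    Tendsto (fun t => f t / (t - x)) (𝓝[≠] x) (𝓝 f') := by
  simpa only [slope_fun_def_field, h0, sub_zero] using hasDerivAt_iff_tendsto_slope.1 hf

/-- RESIDUE OF A QUOTIENT at a simple zero of the denominator: if `N → n` and `F t/(t - x) → d ≠ 0` on
`𝓝[≠] x` then `(x - t) N(t)/F(t) → -n/d` (with Lean's `a/0 = 0` the identity `(x - t)(N/F) = -N/(F/(t - x))`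
holds for every `t`, so no eventual non-vanishing of `F` is needed). [folklore] -/
theorem tendsto_residue {N F : ℝ → ℝ} {x n d : ℝ} (hN : Tendsto N (𝓝[≠] x) (𝓝 n))
    (hF : Tendsto (fun t => F t / (t - x)) (𝓝[≠] x) (𝓝 d)) (hd : d ≠ 0) :
    Tendsto (fun t => (x - t) * (N t / F t)) (𝓝[≠] x) (𝓝 (-n / d)) := by
  refine ((hN.neg).div hF hd).congr fun t => ?_
  show -N t / (F t / (t - x)) = (x - t) * (N t / F t)
  rw [div_div_eq_mul_div]
  ring

/-- `t ↦ x - t` tends to `0` on `𝓝[≠] x`. [folklore] -/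
theorem tendsto_sub_self_punctured (x : ℝ) : Tendsto (fun t : ℝ => x - t) (𝓝[≠] x) (𝓝 0) := by
  have : Tendsto (fun t : ℝ => x - t) (𝓝 x) (𝓝 (x - x)) := (continuous_const.sub continuous_id).tendsto x
  rw [sub_self] at this
  exact tendsto_nhdsWithin_of_tendsto_nhds this

/-- If `g` has a finite punctured limit at `x` then `(x - t) g(t) → 0` on `𝓝[≠] x`. [folklore] -/
theorem tendsto_sub_mul {g : ℝ → ℝ} {x l : ℝ} (hg : Tendsto g (𝓝[≠] x) (𝓝 l)) :
    Tendsto (fun t => (x - t) * g t) (𝓝[≠] x) (𝓝 0) := by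
  simpa using (tendsto_sub_self_punctured x).mul hg

/-- A differentiable function tends to its value on the punctured neighbourhood. [folklore] -/
theorem tendsto_punctured {f : ℝ → ℝ} (hf : Differentiable ℝ f) (x : ℝ) :
    Tendsto f (𝓝[≠] x) (𝓝 (f x)) :=
  tendsto_nhdsWithin_of_tendsto_nhds (hf x).continuousAt.tendsto

/-! ## The mass law, case by case -/

/-- MASS LAW for the parameter `∞` (`m_∞ = A/C`): at a zero `x` of `C` with `κ(x) ≠ 0`,
`(x - t) A(t)/C(t) → -A(x)/C′(x) = 1/κ(x)` (`AD = 1` and `κ = -C′D` there); off the zeros of `C`, `→ 0`.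
[folklore] -/
theorem massLaw_none (R : Resolvent) (x : ℝ) :
    (x ∈ R.atoms none → R.invMass none x ≠ 0 →
        Tendsto (fun t => (x - t) * R.mfun none t) (𝓝[≠] x) (𝓝 (R.invMass none x)⁻¹)) ∧
      (x ∉ R.atoms none → Tendsto (fun t => (x - t) * R.mfun none t) (𝓝[≠] x) (𝓝 0)) := by
  refine ⟨fun (hx : R.C x = 0) (hm : R.κ x ≠ 0) => ?_, fun (hx : R.C x ≠ 0) => tendsto_sub_mul
    (tendsto_nhdsWithin_of_tendsto_nhds ((R.differentiable_A x).continuousAt.div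
      (R.differentiable_C x).continuousAt hx).tendsto)⟩
  show Tendsto (fun t => (x - t) * (R.A t / R.C t)) (𝓝[≠] x) (𝓝 (R.κ x)⁻¹)
  have hdet := R.det x
  rw [hx, mul_zero, sub_zero] at hdet
  have hκ : R.κ x = -(deriv R.C x * R.D x) := by simp [Resolvent.κ, hx]
  have hC' : deriv R.C x ≠ 0 := fun h => hm (by rw [hκ, h, zero_mul, neg_zero])
  have hD : R.D x ≠ 0 := fun h => zero_ne_one (by rw [h, mul_zero] at hdet; exact hdet)
  convert tendsto_residue (tendsto_punctured R.differentiable_A x)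
    (tendsto_div_sub_of_hasDerivAt (R.differentiable_C x).hasDerivAt hx) hC' using 2
  rw [hκ, inv_eq_one_div, div_eq_div_iff (neg_ne_zero.2 (mul_ne_zero hC' hD)) hC']
  linear_combination (-deriv R.C x) * hdet

/-- MASS LAW for a parameter `τ` at a point `x` OFF the poles of `τ`: with `F := Cτ + D`, `N := Aτ + B`, a crossing
is `F(x) = 0`; then `C(x) ≠ 0`, `N(x) C(x) = -1` and `F′(x) C(x) = κ + C²τ′` (termwise differentiation of `τ`), so
`(x - t) m_τ(t) → 1/(κ + C²τ′)`; off the crossings `m_τ` is continuous at `x` and the limit is `0`. [folklore] -/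
theorem massLaw_some_offPole (R : Resolvent) (τ : PickParam) {x : ℝ} (hxp : x ∉ τ.poles) :
    (x ∈ R.atoms (some τ) → R.invMass (some τ) x ≠ 0 →
        Tendsto (fun t => (x - t) * R.mfun (some τ) t) (𝓝[≠] x) (𝓝 (R.invMass (some τ) x)⁻¹)) ∧
      (x ∉ R.atoms (some τ) → Tendsto (fun t => (x - t) * R.mfun (some τ) t) (𝓝[≠] x) (𝓝 0)) := by
  have hval := hasDerivAt_val τ hxp
  have hinv : R.invMass (some τ) x = R.κ x + R.C x ^ 2 * τ.slope x := if_neg hxp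
  have hNc : ContinuousAt (fun t => R.A t * τ.val t + R.B t) x :=
    ((R.differentiable_A x).continuousAt.mul hval.continuousAt).add (R.differentiable_B x).continuousAt
  have hFd : HasDerivAt (fun t => R.C t * τ.val t + R.D t)
      (deriv R.C x * τ.val x + R.C x * τ.slope x + deriv R.D x) x :=
    ((R.differentiable_C x).hasDerivAt.mul hval).add (R.differentiable_D x).hasDerivAt
  refine ⟨fun hx hm => ?_, fun hx => tendsto_sub_mul (tendsto_nhdsWithin_of_tendsto_nhds
    (hNc.div hFd.continuousAt fun h => hx (Or.inl ⟨hxp, h⟩)).tendsto)⟩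
  have hF0 : R.C x * τ.val x + R.D x = 0 := hx.elim And.right fun h => absurd h.1 hxp
  rw [hinv] at hm ⊢
  have hdet := R.det x
  have hCx : R.C x ≠ 0 := by
    intro hC0
    have hD0 : R.D x = 0 := by simpa [hC0] using hF0
    rw [hC0, hD0, mul_zero, mul_zero, sub_zero] at hdet
    exact zero_ne_one hdet
  -- `F′(x) C(x) = κ + C²τ′` and `N(x) C(x) = -1`
  have hd : (deriv R.C x * τ.val x + R.C x * τ.slope x + deriv R.D x) * R.C x
      = R.κ x + R.C x ^ 2 * τ.slope x := by
    simp only [Resolvent.κ]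
    linear_combination (deriv R.C x) * hF0
  have hn : (R.A x * τ.val x + R.B x) * R.C x = -1 := by linear_combination (R.A x) * hF0 - hdet
  have hd0 : deriv R.C x * τ.val x + R.C x * τ.slope x + deriv R.D x ≠ 0 := fun h =>
    hm (by rw [← hd, h, zero_mul])
  show Tendsto (fun t => (x - t) * ((R.A t * τ.val t + R.B t) / (R.C t * τ.val t + R.D t)))
    (𝓝[≠] x) (𝓝 (R.κ x + R.C x ^ 2 * τ.slope x)⁻¹)
  convert tendsto_residue (tendsto_nhdsWithin_of_tendsto_nhds hNc.tendsto)
    (tendsto_div_sub_of_hasDerivAt hFd hF0) hd0 using 2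
  rw [← hd, eq_div_iff hd0]
  field_simp
  linear_combination hn

/-- MASS LAW for a parameter `τ` AT A POLE `x = s_j` (where `τ = ∞` and the crossing condition is `C(x) = 0`):
multiply numerator and denominator of `m_τ` by `(x - t)` and use the pole expansion `(x - t)τ(t) → c_j`; the new
denominator `C(t)(x - t)τ(t) + D(t)(x - t)` has slope `C′(x)c_j - D(x)` at `x`. If `C(x) = 0` the limit is
`-A c_j/(C′c_j - D) = 1/(κ + D²/c_j)` (`AD = 1`, `κ = -C′D`); if `C(x) ≠ 0` the quotient has a finite limit and
`(x - t) m_τ(t) → 0`. [folklore] -/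
theorem massLaw_some_pole (R : Resolvent) (τ : PickParam) {x : ℝ} (hxp : x ∈ τ.poles) :
    (x ∈ R.atoms (some τ) → R.invMass (some τ) x ≠ 0 →
        Tendsto (fun t => (x - t) * R.mfun (some τ) t) (𝓝[≠] x) (𝓝 (R.invMass (some τ) x)⁻¹)) ∧
      (x ∉ R.atoms (some τ) → Tendsto (fun t => (x - t) * R.mfun (some τ) t) (𝓝[≠] x) (𝓝 0)) := by
  obtain ⟨j, hj⟩ := hxp
  have hxp : x ∈ τ.poles := ⟨j, hj⟩
  have hinv : R.invMass (some τ) x = R.κ x + R.D x ^ 2 / τ.c j := by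
    rw [← weight_pole τ j, hj]; exact if_pos hxp
  have hcj := τ.c_pos j
  -- `u(t) := (x - t) τ(t) → c_j`; numerator and denominator of `m_τ` multiplied through by `(x - t)`
  have hu : Tendsto (fun t => (x - t) * τ.val t) (𝓝[≠] x) (𝓝 (τ.c j)) := hj ▸ tendsto_val_pole τ j
  have hsub := tendsto_sub_self_punctured x
  have hN : Tendsto (fun t => R.A t * ((x - t) * τ.val t) + R.B t * (x - t)) (𝓝[≠] x)
      (𝓝 (R.A x * τ.c j)) := by
    simpa using ((tendsto_punctured R.differentiable_A x).mul hu).add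
      ((tendsto_punctured R.differentiable_B x).mul hsub)
  have hFl : Tendsto (fun t => R.C t * ((x - t) * τ.val t) + R.D t * (x - t)) (𝓝[≠] x)
      (𝓝 (R.C x * τ.c j)) := by
    simpa using ((tendsto_punctured R.differentiable_C x).mul hu).add
      ((tendsto_punctured R.differentiable_D x).mul hsub)
  have heq : ∀ᶠ t in 𝓝[≠] x, (x - t) * ((R.A t * ((x - t) * τ.val t) + R.B t * (x - t)) /
      (R.C t * ((x - t) * τ.val t) + R.D t * (x - t))) = (x - t) * R.mfun (some τ) t := by
    filter_upwards [self_mem_nhdsWithin] with t ht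
    show _ = (x - t) * ((R.A t * τ.val t + R.B t) / (R.C t * τ.val t + R.D t))
    rw [← mul_div_mul_left (R.A t * τ.val t + R.B t) _ (sub_ne_zero.2 (Ne.symm ht))]
    ring_nf
  refine ⟨fun hx hm => ?_, fun hx => (tendsto_sub_mul (hN.div hFl (mul_ne_zero
    (fun h => hx (Or.inr ⟨hxp, h⟩)) hcj.ne'))).congr' heq⟩
  have hC0 : R.C x = 0 := hx.elim (fun h => absurd hxp h.1) And.right
  rw [hinv] at hm ⊢
  have hdet := R.det x
  rw [hC0, mul_zero, sub_zero] at hdet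
  have hD0 : R.D x ≠ 0 := fun h => zero_ne_one (by rw [h, mul_zero] at hdet; exact hdet)
  have hκ : R.κ x = -(deriv R.C x * R.D x) := by simp [Resolvent.κ, hC0]
  -- the new denominator has slope `C′(x) c_j - D(x)` at `x`
  have hF : Tendsto (fun t => (R.C t * ((x - t) * τ.val t) + R.D t * (x - t)) / (t - x)) (𝓝[≠] x)
      (𝓝 (deriv R.C x * τ.c j - R.D x)) := by
    refine (((tendsto_div_sub_of_hasDerivAt (R.differentiable_C x).hasDerivAt hC0).mul hu).sub
      (tendsto_punctured R.differentiable_D x)).congr' ?_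
    filter_upwards [self_mem_nhdsWithin] with t ht
    have hxt : t - x ≠ 0 := sub_ne_zero.2 ht
    field_simp
    ring
  have hd : deriv R.C x * τ.c j - R.D x ≠ 0 := by
    intro h0
    apply hm
    rw [hκ, show deriv R.C x = R.D x / τ.c j by rw [eq_div_iff hcj.ne']; linear_combination h0]
    field_simp
    ring
  convert (tendsto_residue hN hF hd).congr' heq using 2
  have hc0 : τ.c j ≠ 0 := hcj.ne'
  rw [hκ, show R.A x = 1 / R.D x by rw [eq_div_iff hD0]; exact hdet]
  apply inv_eq_of_mul_eq_one_right
  field_simp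
  ring

end MassLaw

open MassLaw in
/-- **`stub_massLaw`** (registered stub of the line `pick-slope`, crux stmt-RiemannHypothesis-11196) — the
MASS LAW as a residue computation on the real axis, for ANY real-axis resolvent data `(A B; C D)`, `AD - BC = 1`,
and ANY parameter: at a crossing `x` with non-degenerate predicted mass, `(x - t)·m_p(t) → (invMass p x)⁻¹`
(`= 1/(κ + C²τ′)` off the poles of `τ`, `= 1/(κ + D²/c_k)` at a pole `s_k` with `C(s_k) = 0`, `= 1/κ` for
`p = ∞`), and `→ 0` off the crossing set. Pure real calculus (termwise differentiation of the Mittag-Leffler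
series of `τ` and its pole expansion); RH-free. [folklore] -/
theorem stub_massLaw : ∀ (R : Resolvent) (p : Option PickParam) (x : ℝ),
    (x ∈ R.atoms p → R.invMass p x ≠ 0 →
      Tendsto (fun t => (x - t) * R.mfun p t) (𝓝[≠] x) (𝓝 (R.invMass p x)⁻¹)) ∧
    (x ∉ R.atoms p → Tendsto (fun t => (x - t) * R.mfun p t) (𝓝[≠] x) (𝓝 0)) := by
  intro R p x
  cases p with
  | none => exact massLaw_none R x
  | some τ =>
    by_cases hxp : x ∈ τ.poles
    · exact massLaw_some_pole R τ hxp
    · exact massLaw_some_offPole R τ hxp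

end Summit.RiemannHypothesis.RiemannHypothesis.Theorems.PickSlope

end
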